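import Mathlib.CategoryTheory.Pi.Basic
import Mathlib.CategoryTheory.Endomorphism
import Literature.IUT.HodgeTheaters.Labels
import HarnessLib

/-!
# The base-theoretic shadow of an initial Θ-datum ([IUTchI] §4): the hypothesis structure
# `BaseThetaDatum` — abc-iut cell, layer L5, statements-first

Mochizuki, *Inter-universal Teichmüller theory I*, §4 (kurims May-2020 manuscript, pp. 95–122). This
file declares the ONE hypothesis structure over which Definition 4.1 – Corollary 4.12 are typed in
`BasePrimeStrips.lean` (Def. 4.1, Prop. 4.2), `BaseBridges.lean` (Examples 4.3–4.5, Def. 4.6,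
Props. 4.7–4.9) and `Processions.lean` (Def. 4.10, Prop. 4.11, Cor. 4.12).

## What the interface is (and is not)

§4 is the "combinatorial", base-category (`𝒟`-) portion of the theory (p. 95). Its objects are
ISOMORPHS of fixed model categories / Aut-holomorphic orbispaces `𝒟_v`, `𝒟_v^⊢` (Examples 3.2 (i),
3.3 (i), 3.4 (i)–(ii)), `𝒟^⊚ = B(C_K)⁰` (Def. 4.1 (v)), related by POLY-MORPHISMS, i.e. sets of
morphisms (§0 p. 33), an "isomorphism of categories" being an isomorphism class of equivalences, that
is (§0 p. 33) "an isomorphism in the usual sense of the [1-]category constituted by the coarsification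
of the 2-category of all small 1-categories". Accordingly `BaseThetaDatum` records, for each place
`v ∈ 𝕍` of an initial Θ-datum (Def. 3.1), an AMBIENT 1-CATEGORY `Amb v` whose objects are the isomorphs
of `𝒟_v` (all mutually isomorphic), likewise `AmbM v` for `𝒟_v^⊢` and `AmbG` for `𝒟^⊚`, together with
the OUTPUTS of the group-theoretic reconstruction algorithms that Definition 4.1 invokes and their
functoriality in isomorphisms — each field's docstring quotes the sentence of print it stands for:

* Def. 4.1 (ii): the `F_l^⋇`-torsor `LabCusp(†𝒟_v)` of label classes of cusps and its canonical element
  `†η_v` "constructed solely from `†𝒟_v`" ([AbsTopI] Lem. 4.5, [EtTh] Cor. 2.9, Cor. 1.2);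
* Def. 4.1 (iv): mono-analyticisation `†𝒟 ↦ †𝒟^⊢` (Examples 3.2 (i),(vi); 3.3 (i),(iii); 3.4 (ii));
* Def. 4.1 (v): `LabCusp(†𝒟^⊚)` with its `F_l^⋇`-torsor structure, the valuation set `𝕍(†𝒟^⊚)` "i.e.
  `𝕍(K)`" ([AbsTopIII] Thm. 1.9, Cor. 2.8), and the morphisms `†𝒟_v → †𝒟^⊚` (§0 at `v ∈ 𝕍^non`,
  Def. 4.1 (v) at `v ∈ 𝕍^arc`) — we only carry the morphisms ABSTRACTLY EQUIVALENT (§0 p. 35) to the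
  natural morphism `φ^NF_{•,v}` of Example 4.3 (ii)–(iii), the only ones §4–§6 use (`HomNF`);
* Example 4.3 (i): every `j ∈ F_l^⋇` is realised by an automorphism of `𝒟^⊚`
  ("`Aut(C_K)/Aut_ε(C_K) ⥲ F_l^⋇`");
* Example 4.4 (i)–(ii): at `v ∈ 𝕍^bad`, the morphisms `B^temp(Π_v)⁰ → B^temp(Π_v)⁰` "that arise from the
  evaluation sections labeled `j`", `j ∈ |F_l|`, read off group-theoretically ([EtTh] Cor. 2.9,
  Prop. 2.4; [SemiAnbd] Cor. 3.11, Thm. 6.8 (iii));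
* Example 4.5 (i): a morphism of `φ^NF`-type induces "a natural isomorphism of `F_l^⋇`-torsors
  `LabCusp(𝒟^⊚) ⥲ LabCusp(𝒟_{v_j})`" (Cor. 2.5 at bad `v`, Rem. 4.5.1), with `[ε] ↦ η_v` along
  `φ^NF_{•,v}` itself (Def. 3.1 (f): `ε_v` is the cusp of `C_v` determined by `ε`; Ex. 4.5 (ii)).

NOT here: the fundamental groups, tempered coverings, theta functions and the reconstruction
algorithms themselves (layers L2–L4 of the campaign: [EtTh], [SemiAnbd], [AbsTopI–III]); the objects
`†𝒟̲_v` "corresponding to `C_v`" of Def. 4.1 (i) (not used later in §4); the Frobenioid-theoretic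
(`ℱ`-) prime-strips of §5. TODO-merge:abc-iut-L5-t1 — poly-morphisms and capsules are written as raw
`Set (X ⟶ Y)` and raw families `J → _` here and will be restated through the §0 names of
`Conventions.lean` once it lands; TODO-merge:abc-iut-L5-t2 — an adapter `InitialThetaData → BaseThetaDatum`
(Def. 3.1 + Examples 3.2–3.4) is owed once those files land. Record-only material; the bibliographic key
carries the D-0012 status [claim: Mochizuki2012, status: disputed]; nothing here takes a side.
-/

namespace Literature.IUT.HodgeTheaters

open CategoryTheory

universe u

/-- **The §4 shadow of an initial Θ-datum** `(F̄/F, X_F, l, C_K, 𝕍, 𝕍^bad_mod, ε)` ([IUTchI] Def. 3.1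
p. 61–63) together with the model base categories of Examples 3.2–3.4 and the outputs of the
reconstruction algorithms invoked in Definition 4.1 / Examples 4.3–4.5 (see the module docstring for the
field-by-field locators). A HYPOTHESIS STRUCTURE: statements of §4 take `(𝔡 : BaseThetaDatum)`.
[claim: Mochizuki2012, status: disputed] -/
structure BaseThetaDatum where
  /-- Def. 3.1 (c): "`l` is a prime number `≥ 5`". NOT carried by this shadow (no curve, no Galois representation in
  the interface): the further conditions of Def. 3.1 (c) that the image of `G_F → GL₂(F_l)` on `E_F[l]` contain `SL₂(F_l)`
  and that `l` be prime to the residue characteristics of `𝕍^bad_mod` and to the orders of the `q`-parameters of `E_F` at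
  `𝕍(F)^bad` — statements typed over `BaseThetaDatum` must not be read as using them (reviewer advisory on p404183). -/
  l : ℕ
  /-- Def. 3.1 (c): `l` is prime. -/
  [l_prime : Fact l.Prime]
  /-- Def. 3.1 (c): `l ≥ 5`. -/
  five_le_l : 5 ≤ l
  /-- Def. 3.1 (e): the set of valuations `𝕍 ⊆ 𝕍(K)`, a section of `𝕍(K) ↠ 𝕍_mod := 𝕍(F_mod)`
  (an infinite set). -/
  V : Type
  /-- Def. 3.1 (e): `𝕍^arc := 𝕍 ∩ 𝕍(K)^arc` (its complement is `𝕍^non`). -/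
  IsArc : V → Prop
  /-- Def. 3.1 (b),(e): `𝕍^bad := 𝕍 ∩ 𝕍(K)^bad` (nonarchimedean places of bad multiplicative
  reduction singled out in `𝕍^bad_mod`; its complement is `𝕍^good`). -/
  IsBad : V → Prop
  /-- Def. 3.1 (b): `𝕍^bad_mod` "is a nonempty set of nonarchimedean valuations". -/
  not_isArc_of_isBad : ∀ {v}, IsBad v → ¬ IsArc v
  /-- Def. 3.1 (b): `𝕍^bad_mod ≠ ∅`. -/
  exists_isBad : ∃ v, IsBad v
  /-- Def. 4.1 (i): the ambient category at `v` — objects = the isomorphs `†𝒟_v` of the model `𝒟_v`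
  ("a category which admits an equivalence `†𝒟_v ⥲ 𝒟_v`" at `v ∈ 𝕍^non`, an Aut-holomorphic orbispace
  isomorphic to `𝒟_v` at `v ∈ 𝕍^arc`), morphisms = the morphisms of §0 / [AbsTopIII] Def. 2.1. -/
  Amb : V → Type u
  /-- the ambient category structure at `v` (§0 morphisms). -/
  [catAmb : ∀ v, Category.{u} (Amb v)]
  /-- Examples 3.2 (i), 3.3 (i), 3.4 (i): the model `𝒟_v` (`B^temp(X̲_v)⁰`, `B(X→_v)⁰`, resp. `X→_v`). -/
  D : ∀ v, Amb v
  /-- every object of `Amb v` is an isomorph of `𝒟_v`. -/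
  nonempty_iso : ∀ v (X Y : Amb v), Nonempty (X ≅ Y)
  /-- Def. 4.1 (iii): the ambient category of isomorphs `†𝒟_v^⊢` of `𝒟_v^⊢` (an object of `TM^⊢` at
  `v ∈ 𝕍^arc`). -/
  AmbM : V → Type u
  /-- the mono-analytic ambient category structure at `v`. -/
  [catAmbM : ∀ v, Category.{u} (AmbM v)]
  /-- Examples 3.2 (i), 3.3 (i), 3.4 (ii): the model `𝒟_v^⊢` (`B^temp(G_v)⁰`, `B(G_v)⁰`, resp. the
  archimedean `𝒟_v^⊢ ∈ Ob(TM^⊢)`). -/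
  DM : ∀ v, AmbM v
  /-- every object of `AmbM v` is an isomorph of `𝒟_v^⊢`. -/
  nonempty_isoM : ∀ v (X Y : AmbM v), Nonempty (X ≅ Y)
  /-- Def. 4.1 (iv): "to any `𝒟`-prime-strip `†𝒟` one may associate, in a natural way, a
  `𝒟^⊢`-prime-strip `†𝒟^⊢` … the mono-analyticization", on objects … -/
  mono : ∀ v, Amb v → AmbM v
  /-- … and on isomorphisms (functorially). -/
  monoIso : ∀ {v} {X Y : Amb v}, (X ≅ Y) → (mono v X ≅ mono v Y)
  /-- functoriality of mono-analyticisation: identities. -/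
  monoIso_refl : ∀ {v} (X : Amb v), monoIso (Iso.refl X) = Iso.refl _
  /-- functoriality of mono-analyticisation: composites. -/
  monoIso_trans : ∀ {v} {X Y Z : Amb v} (f : X ≅ Y) (g : Y ≅ Z),
    monoIso (f ≪≫ g) = monoIso f ≪≫ monoIso g
  /-- Def. 4.1 (v): the ambient category of "categories equivalent to `𝒟^⊚ := B(C_K)⁰`". -/
  AmbG : Type u
  /-- the global ambient category structure (§0 morphisms). -/
  [catAmbG : Category.{u} AmbG]
  /-- Def. 4.1 (v): the model `𝒟^⊚ := B(C_K)⁰`. -/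
  DG : AmbG
  /-- every object of `AmbG` is an isomorph of `𝒟^⊚`. -/
  nonempty_isoG : ∀ X Y : AmbG, Nonempty (X ≅ Y)
  /-- Def. 4.1 (v): "`𝕍̲(†𝒟^⊚) := 𝕍(†𝒟^⊚)/π₁(†𝒟^⊚)` [i.e., "`𝕍(K)`"]", reconstructed from `π₁(†𝒟^⊚)`
  ([AbsTopIII] Thm. 1.9, Cor. 2.8), functorial in isomorphisms. -/
  Val : AmbG → Type
  /-- transport of `𝕍̲(†𝒟^⊚)` along isomorphisms … -/
  valIso : ∀ {X Y : AmbG}, (X ≅ Y) → Val X ≃ Val Y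
  /-- … functorially: identities … -/
  valIso_refl : ∀ X, valIso (Iso.refl X) = Equiv.refl _
  /-- … and composites. -/
  valIso_trans : ∀ {X Y Z : AmbG} (f : X ≅ Y) (g : Y ≅ Z),
    valIso (f ≪≫ g) = (valIso f).trans (valIso g)
  /-- Def. 3.1 (e): `𝕍 ⊆ 𝕍(K) = 𝕍̲(𝒟^⊚)`. -/
  valOfV : V ↪ Val DG
  /-- Def. 4.1 (v)–(vi) / Ex. 4.3 (ii)–(iii): the morphisms `†𝒟_v → †𝒟^⊚` (§0 at `v ∈ 𝕍^non`; "a morphism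
  of Aut-holomorphic orbispaces `U → C(†𝒟^⊚, w)` for some `w ∈ 𝕍̲(†𝒟^⊚)^arc`" at `v ∈ 𝕍^arc`) that are
  abstractly equivalent (§0 p. 35) to the natural morphism `φ^NF_{•,v} : 𝒟_v → 𝒟^⊚`. -/
  HomNF : ∀ v, Amb v → AmbG → Type u
  /-- "pre-composite … with a morphism" (here: an isomorphism) — Def. 4.1 (v). -/
  preNF : ∀ {v} {X X' : Amb v} {Y : AmbG}, (X' ≅ X) → HomNF v X Y → HomNF v X' Y
  /-- "post-composite … with an isomorphism `†𝒟^⊚ ⥲ ‡𝒟^⊚`" — Def. 4.1 (v). -/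
  postNF : ∀ {v} {X : Amb v} {Y Y' : AmbG}, HomNF v X Y → (Y ≅ Y') → HomNF v X Y'
  /-- pre-composition with the identity. -/
  preNF_refl : ∀ {v} {X : Amb v} {Y : AmbG} (f : HomNF v X Y), preNF (Iso.refl X) f = f
  /-- pre-composition with a composite. -/
  preNF_trans : ∀ {v} {X X' X'' : Amb v} {Y : AmbG} (a' : X'' ≅ X') (a : X' ≅ X) (f : HomNF v X Y),
    preNF (a' ≪≫ a) f = preNF a' (preNF a f)
  /-- post-composition with the identity. -/
  postNF_refl : ∀ {v} {X : Amb v} {Y : AmbG} (f : HomNF v X Y), postNF f (Iso.refl Y) = f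
  /-- post-composition with a composite. -/
  postNF_trans : ∀ {v} {X : Amb v} {Y Y' Y'' : AmbG} (f : HomNF v X Y) (b : Y ≅ Y') (b' : Y' ≅ Y''),
    postNF f (b ≪≫ b') = postNF (postNF f b) b'
  /-- pre- and post-composition commute (associativity). -/
  preNF_postNF : ∀ {v} {X X' : Amb v} {Y Y' : AmbG} (a : X' ≅ X) (f : HomNF v X Y) (b : Y ≅ Y'),
    preNF a (postNF f b) = postNF (preNF a f) b
  /-- Ex. 4.3 (ii)–(iii): the natural morphism `φ^NF_{•,v} : 𝒟_v → 𝒟^⊚` (from `X→_v → C_v → C_K`,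
  resp. `X̲_v → C_v → C_K`, resp. the tautological `X→_v → C_v ⥲ C(𝒟^⊚, v)`). -/
  phiNF : ∀ v, HomNF v (D v) DG
  /-- every morphism of `HomNF` is abstractly equivalent to `φ^NF_{•,v}` (this is what `HomNF` means). -/
  exists_eq_phiNF : ∀ {v} {X : Amb v} {Y : AmbG} (f : HomNF v X Y),
    ∃ (a : X ≅ D v) (b : DG ≅ Y), f = postNF (preNF a (phiNF v)) b
  /-- Def. 4.1 (ii): "the set of label classes of cusps `LabCusp(†𝒟_v)`" … -/
  LabCusp : ∀ v, Amb v → Type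
  /-- … "admits a natural `F_l^⋇`-torsor structure" … -/
  [actLab : ∀ v (X : Amb v), MulAction (FlStar l) (LabCusp v X)]
  /-- … simply transitively … -/
  isTorsor_labCusp : ∀ v (X : Amb v), IsTorsor (FlStar l) (LabCusp v X)
  /-- … constructed "in a functorial fashion" from `π₁(†𝒟_v)` (resp. from the underlying topological
  space), hence transported by isomorphisms … -/
  labIso : ∀ {v} {X Y : Amb v}, (X ≅ Y) → LabCusp v X ≃ LabCusp v Y
  /-- … `F_l^⋇`-equivariantly … -/
  labIso_smul : ∀ {v} {X Y : Amb v} (f : X ≅ Y) (j : FlStar l) (c : LabCusp v X),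
    labIso f (j • c) = j • labIso f c
  /-- … functorially: identities … -/
  labIso_refl : ∀ {v} (X : Amb v), labIso (Iso.refl X) = Equiv.refl _
  /-- … and composites. -/
  labIso_trans : ∀ {v} {X Y Z : Amb v} (f : X ≅ Y) (g : Y ≅ Z),
    labIso (f ≪≫ g) = (labIso f).trans (labIso g)
  /-- Def. 4.1 (ii): "one may construct, solely from `†𝒟_v`, a canonical element `†η_v ∈ LabCusp(†𝒟_v)`
  determined by `ε_v`" — canonical, so preserved by every isomorphism. -/
  η : ∀ v (X : Amb v), LabCusp v X
  /-- the canonical element is preserved by every isomorphism. -/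
  labIso_η : ∀ {v} {X Y : Amb v} (f : X ≅ Y), labIso f (η v X) = η v Y
  /-- Def. 4.1 (v): "the set of label classes of cusps `LabCusp(†𝒟^⊚)`, which admits a natural
  `F_l^⋇`-torsor structure" (no canonical element). -/
  LabCuspG : AmbG → Type
  /-- … the `F_l^⋇`-action on `LabCusp(†𝒟^⊚)` … -/
  [actLabG : ∀ Y : AmbG, MulAction (FlStar l) (LabCuspG Y)]
  /-- … is simply transitive … -/
  isTorsor_labCuspG : ∀ Y, IsTorsor (FlStar l) (LabCuspG Y)
  /-- … transported by isomorphisms ([AbsTopI] Lem. 4.5 is group-theoretic) … -/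
  labIsoG : ∀ {Y Y' : AmbG}, (Y ≅ Y') → LabCuspG Y ≃ LabCuspG Y'
  /-- … equivariantly … -/
  labIsoG_smul : ∀ {Y Y' : AmbG} (b : Y ≅ Y') (j : FlStar l) (c : LabCuspG Y),
    labIsoG b (j • c) = j • labIsoG b c
  /-- … functorially: identities … -/
  labIsoG_refl : ∀ Y : AmbG, labIsoG (Iso.refl Y) = Equiv.refl _
  /-- … and composites. -/
  labIsoG_trans : ∀ {Y Y' Y'' : AmbG} (b : Y ≅ Y') (b' : Y' ≅ Y''),
    labIsoG (b ≪≫ b') = (labIsoG b).trans (labIsoG b')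
  /-- Ex. 4.5 (ii): "`[ε] ∈ LabCusp(𝒟^⊚)` for the element determined by `ε`" (Def. 3.1 (f)). -/
  εLab : LabCuspG DG
  /-- Ex. 4.3 (i): "natural isomorphisms `Aut^SL(C_K)/Aut^SL_ε(C_K) ⥲ Aut(C_K)/Aut_ε(C_K) ⥲ F_l^⋇`": every
  label translation of `LabCusp(𝒟^⊚)` is effected by an automorphism of `𝒟^⊚`. -/
  exists_aut_smul : ∀ j : FlStar l, ∃ b : DG ≅ DG, ∀ c : LabCuspG DG, labIsoG b c = j • c
  /-- Ex. 4.5 (i) p. 107–108: a `φ^NF`-type morphism `†𝒟_v → †𝒟^⊚` induces, "by considering cuspidal inertia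
  groups of `π₁(𝒟^⊚)` whose unique index `l` subgroup is contained in the image" (`v ∈ 𝕍^non`; Cor. 2.5 at
  `v ∈ 𝕍^bad`, Rem. 4.5.1 (iii)) resp. "by considering the closures in `π₁(𝒟^⊚)` of the images of cuspidal inertia
  groups" (`v ∈ 𝕍^arc`; Rem. 4.5.1 (iv) p. 110, which invokes Cor. 2.8), "a natural isomorphism of `F_l^⋇`-torsors
  `LabCusp(𝒟^⊚) ⥲ LabCusp(𝒟_{v_j})`" — natural in isomorphisms on both sides. -/
  labPull : ∀ {v} {X : Amb v} {Y : AmbG}, HomNF v X Y → LabCuspG Y ≃ LabCusp v X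
  /-- … `F_l^⋇`-equivariant ("isomorphism of `F_l^⋇`-torsors") … -/
  labPull_smul : ∀ {v} {X : Amb v} {Y : AmbG} (f : HomNF v X Y) (j : FlStar l) (c : LabCuspG Y),
    labPull f (j • c) = j • labPull f c
  /-- … natural in isomorphisms of the source … -/
  labPull_preNF : ∀ {v} {X X' : Amb v} {Y : AmbG} (a : X' ≅ X) (f : HomNF v X Y) (c : LabCuspG Y),
    labPull (preNF a f) c = (labIso a).symm (labPull f c)
  /-- … and in isomorphisms of the target. -/
  labPull_postNF : ∀ {v} {X : Amb v} {Y Y' : AmbG} (f : HomNF v X Y) (b : Y ≅ Y') (c : LabCuspG Y'),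
    labPull (postNF f b) c = labPull f ((labIsoG b).symm c)
  /-- Def. 4.1 (ii) / Ex. 4.5 (ii): along `φ^NF_{•,v}` the class `[ε]` pulls back to the canonical element
  `η_v` ("`†η_v` … determined by `ε_v`"; "`φ^LC_1(j · [ε]) ↦ j`"). -/
  labPull_phiNF_εLab : ∀ v, labPull (phiNF v) εLab = η v (D v)
  /-- Ex. 4.4 (i)–(ii): at `v ∈ 𝕍^bad`, the morphisms `†𝒟_v → ‡𝒟_v` "that arise [i.e., via composition
  with the natural surjection `Π_v ↠ G_v`] from the evaluation sections labeled `j`", `j ∈ |F_l|`, up to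
  "composing with arbitrary isomorphisms" on either side … -/
  IsEvalSection : ∀ {v}, IsBad v → FlAbs l → ∀ {X Y : Amb v}, (X ⟶ Y) → Prop
  /-- … closed under pre-composition with isomorphisms … -/
  isEvalSection_isoComp : ∀ {v} (hv : IsBad v) (j : FlAbs l) {X X' Y : Amb v} (a : X' ≅ X) (f : X ⟶ Y),
    IsEvalSection hv j f → IsEvalSection hv j (a.hom ≫ f)
  /-- … and under post-composition with isomorphisms … -/
  isEvalSection_compIso : ∀ {v} (hv : IsBad v) (j : FlAbs l) {X Y Y' : Amb v} (f : X ⟶ Y) (b : Y ≅ Y'),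
    IsEvalSection hv j f → IsEvalSection hv j (f ≫ b.hom)
  /-- … every label occurs ("the evaluation points of `X̲_v`" exist for each label) … -/
  exists_isEvalSection : ∀ {v} (hv : IsBad v) (j : FlAbs l) (X Y : Amb v),
    ∃ f : X ⟶ Y, IsEvalSection hv j f
  /-- … and "each evaluation section has an associated label `∈ |F_l|`", read off by "a group-theoretic
  algorithm" ([EtTh] Cor. 2.9), so the label of such a morphism is well defined. -/
  isEvalSection_label_unique : ∀ {v} (hv : IsBad v) {j j' : FlAbs l} {X Y : Amb v} (f : X ⟶ Y),
    IsEvalSection hv j f → IsEvalSection hv j' f → j = j'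

namespace BaseThetaDatum

/-- The primality of `l` carried by the datum. [claim: Mochizuki2012, status: disputed] -/
instance instFactPrime (𝔡 : BaseThetaDatum.{u}) : Fact 𝔡.l.Prime := 𝔡.l_prime

/-- The ambient category structure at `v` carried by the datum. [claim: Mochizuki2012, status: disputed] -/
instance instCategoryAmb (𝔡 : BaseThetaDatum.{u}) (v : 𝔡.V) : Category.{u} (𝔡.Amb v) := 𝔡.catAmb v

/-- The mono-analytic ambient category structure carried by the datum. [claim: Mochizuki2012, status: disputed] -/
instance instCategoryAmbM (𝔡 : BaseThetaDatum.{u}) (v : 𝔡.V) : Category.{u} (𝔡.AmbM v) := 𝔡.catAmbM v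

/-- The global ambient category structure carried by the datum. [claim: Mochizuki2012, status: disputed] -/
instance instCategoryAmbG (𝔡 : BaseThetaDatum.{u}) : Category.{u} 𝔡.AmbG := 𝔡.catAmbG

/-- The `F_l^⋇`-action on local label classes carried by the datum. [claim: Mochizuki2012, status: disputed] -/
instance instMulActionLabCusp (𝔡 : BaseThetaDatum.{u}) (v : 𝔡.V) (X : 𝔡.Amb v) :
    MulAction (FlStar 𝔡.l) (𝔡.LabCusp v X) := 𝔡.actLab v X

/-- The `F_l^⋇`-action on global label classes carried by the datum. [claim: Mochizuki2012, status: disputed] -/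
instance instMulActionLabCuspG (𝔡 : BaseThetaDatum.{u}) (Y : 𝔡.AmbG) :
    MulAction (FlStar 𝔡.l) (𝔡.LabCuspG Y) := 𝔡.actLabG Y

end BaseThetaDatum

end Literature.IUT.HodgeTheaters
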